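import Literature.MathematicalPhysics.KineticTheory.LanfordTensorisedHierarchy
import Literature.MathematicalPhysics.KineticTheory.LanfordModeAConvergence
import Literature.MathematicalPhysics.KineticTheory.BoltzmannSolutionsProofs
import HarnessLib

/-!
# Lanford's theorem: the assembly, and the reduction to the BBGKY-side term-by-term analysis

(Topic MathematicalPhysics/KineticTheory; layer L6 of the bottom-up proof plan of the named fact
`Literature.MathematicalPhysics.KineticTheory.lanford` — **hilbert6.S02**, Lanford's theorem for hard
spheres on `T^d`, `Literature/MathematicalPhysics/KineticTheory/Sweep1.lean`. Theorems only: no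
definition, no named fact. This file does NOT discharge `lanford`.)

Cercignani–Illner–Pulvirenti 1994, Thm 4.4.1 (p. 77) prove Lanford's theorem in four steps: Step 1,
term-by-term convergence of the BBGKY series (4.7) to the Boltzmann series (4.8); Step 2, dominated
convergence; Step 3, the common geometric majorant on a short time interval; Step 4, uniqueness for
the Boltzmann hierarchy and factorisation `f^{(s)} = f^{⊗s}` with `f` the mild Boltzmann solution.
Gallagher–Saint-Raymond–Texier 2013 (Thm 8) organise Part II (uniform bounds: Thm 6 for the BBGKY
hierarchy, Thm 7 for the Boltzmann hierarchy) and Part III (term-by-term convergence) the same way. In the tree, Step 2 is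
`propagatesChaos_of_hasSum` (`LanfordModeAConvergence`), Steps 3–4 on the Boltzmann side are
`IsMildBoltzmannSolutionOn.hasSum_boltzmannDuhamelTerm_tensorPow_of_le`
(`LanfordTensorisedHierarchy`), and the limit `f` is the Ukai–Lanford solution
(`ukai_lanford_lwp_holds`, hilbert6.S13). This file PROVES the assembly of these pieces into the
statement `lanford` as printed in `Sweep1`, CONDITIONALLY on the one input that is not in the tree:
the BBGKY side of Steps 1 and 3 for the grand-canonical hard-sphere gas on `T^d` — for every
Lanford datum, every `ε_k → 0⁺` and all hard-sphere flows, measurable functions `A_k^{(s),n}(t)`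
(the Duhamel terms of the grand-canonical BBGKY hierarchy) with uniform majorants
`M_s rⁿ e^{-β E}`, whose sums are versions of the rescaled correlation functions of the evolved
Gibbs state, and which converge term by term, in the sense of observables and locally uniformly
off the diagonal, to the Boltzmann Duhamel terms `Q⁰_{s,s+n}(t) f₀^{⊗(s+n)}` (GST 2013 Part III,
proof of Thm 8; CIP 1994 Thm 4.4.1 Step 1). Precisely:

* `abs_velocityAverage_sub_le_of_forall_notMem`, `forall_abs_velocityAverage_sub_le_of_bad` (§1)
  — the form in which GST Part III delivers term-by-term convergence: closeness of two
  Gaussian-bounded `s`-particle functions at every velocity configuration outside a *bad set* of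
  small Gaussian measure (pathological root velocities leading to recollisions, large energies: in
  the proof of Thm 8 the root velocities are integrated over `B_R ∖ ℳ_s(X_s)`, arXiv text Ch. 18 §2,
  held p. 87) implies closeness of their velocity averages `I_φ` (`Kinetic.velocityAverage`); and the
  Gaussian tail `∫_{∑|v_i|² > R} e^{-β E} dV_s → 0` of the energy truncation
  (`tendsto_setIntegral_exp_neg_mul_sum_norm_sq`; arXiv text Ch. 9 §2 "Energy truncation", held
  p. 39, where the cost is `e^{-C' β₀ R²}`).
* `ContinuousInLanfordOn.mono`, `exists_ukaiLanford_uniform` (§2) — the Ukai–Lanford solution with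
  a Gaussian bound UNIFORM over the Lanford class: for `β₀, C₀ > 0` there are `T₀ = T₀(d, β₀, C₀) > 0`
  such that every Lanford datum `f₀` (`IsLanfordDatum β₀ C₀ f₀`) launches a mild hard-sphere
  Boltzmann solution `f ∈ C([0, T₀]; X_{β₀/2})`, `f(0) = f₀`, with `|f(t, x, v)| ≤ 2 C₀ e^{-β₀|v|²/4}`
  on `[0, T₀]` (existence in the class from `ukai_lanford_lwp_holds`; the bound by comparison, through
  the uniqueness theorem `hardSphere_mild_unique`, with the scale-space solution of
  `hardSphere_mild_exists`, GST 2013 Part II Ch. 5 Thm 7).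
* `lanford_of_bbgkySide` (§3) — **the reduction**: the BBGKY-side input above implies `lanford`,
  with Lanford's time `T = min (T₀, T_Σ, T_B)`, `T_Σ = (√(β₀/2))^{d+1} / (2 C_d max(2C₀, 1))` the
  summation time of the Boltzmann Duhamel series (`C_d` the chain constant of
  `hasSum_boltzmannDuhamelTerm_of_le`) and `T_B` the horizon of the input; all three depend on
  `(d, β₀, C₀)` only, as the statement requires.

The hypothesis of `lanford_of_bbgkySide` is not `lanford`, nor a rewording of it: it concerns the
Duhamel terms of the BBGKY hierarchy (objects absent from the statement of `lanford`), asks for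
their a priori bounds (GST Thm 6 / CIP Step 3, BBGKY half) and for their term-by-term convergence
(GST Part III / CIP Step 1), and says nothing about the Boltzmann equation, its solution or the
summation of either series. It is the conjunction of the remaining layers of the bottom-up plan
(grand-canonical BBGKY Duhamel representation of the evolved correlation functions a.e. — downstream
of `Literature.Analysis.FluidPDE.liouville_imp_bbgky` —, uniform bounds for the BBGKY Duhamel terms,
elimination of recollisions), stated in the exact form the assembly consumes.

## References

* C. Cercignani, R. Illner, M. Pulvirenti, *The Mathematical Theory of Dilute Gases*, Applied
  Mathematical Sciences 106, Springer (1994), §4.4 Thm 4.4.1 and its proof, Steps 1–4, pp. 77–86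
  (held: `lit read book:cercignani1994-mathematical-theory-dilute-gases`, PDF pp. 85–94; bib key
  `CIP1994` / `CercignaniIllnerPulvirenti1994`).
* I. Gallagher, L. Saint-Raymond, B. Texier, *From Newton to Boltzmann: hard spheres and short-range
  potentials*, EMS ZLAM (2013) = arXiv:1208.5753 (held: `lit read paper:arxiv-1208.5753`; locators
  refer to that text): Def. 2.1 and Thm 8 (p. 35), Thm 6 (p. 25), Thm 7 (p. 26), Ch. 9 "Strategy of
  the convergence proof" §§1–4 (pp. 38–41: finite number of collision times, energy truncation, time
  separation, pseudo-trajectories), Ch. 18 §2 "Proof of convergence for the hard sphere dynamics: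
  proof of Theorem 8" (pp. 87–88) (bib key `GST2013`).
* O. E. Lanford, *Time evolution of large classical systems*, Lecture Notes in Physics 38 (1975)
  1–111 (bib key `Lanford1975`).
-/

open MeasureTheory Metric Real Set Filter Topology Function
open scoped ENNReal

namespace Literature.MathematicalPhysics.KineticTheory

noncomputable section

open Literature.Analysis.FluidPDE

variable {d : Type*} [Fintype d]

/-! ## §1. Velocity averages: from pointwise closeness off a bad set to closeness of observables -/

section BadSets

variable {X : Type*} [MeasurableSpace X] {s : ℕ}

/-- A Gaussian-bounded measurable `s`-particle function tested against a bounded measurable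
velocity observable gives an integrable velocity integrand at fixed positions. [folklore] -/
theorem integrable_mul_comp_zipVel {φ : (Fin s → EuclideanSpace ℝ d) → ℝ} {Cφ : ℝ}
    (hφm : Measurable φ) (hφb : ∀ V, |φ V| ≤ Cφ) {A : Config s d X → ℝ} (hAm : Measurable A)
    {Mb β : ℝ} (hβ : 0 < β) (hA : ∀ Z, |A Z| ≤ Mb * exp (-β * configEnergy Z)) (xs : Fin s → X) :
    Integrable fun V : Fin s → EuclideanSpace ℝ d => φ V * A (fun i => (xs i, V i)) := by
  refine Integrable.mono' (((integrable_exp_neg_mul_configEnergy_zipVel hβ xs).const_mul (Cφ * Mb)))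
    ((hφm.mul (hAm.comp (measurable_zipVel xs))).aestronglyMeasurable) (Eventually.of_forall fun V => ?_)
  rw [Real.norm_eq_abs, abs_mul]
  calc |φ V| * |A fun i => (xs i, V i)| ≤ Cφ * (Mb * exp (-β * configEnergy (fun i => (xs i, V i) : Config s d X))) :=
        mul_le_mul (hφb V) (hA _) (abs_nonneg _) ((abs_nonneg _).trans (hφb V))
    _ = Cφ * Mb * exp (-β * configEnergy (fun i => (xs i, V i) : Config s d X)) := by ring

/-- **From pointwise closeness off a bad set to closeness of the velocity averages.** Let `A`, `B` be
measurable `s`-particle functions with the Gaussian bound `M e^{-β E}`, `φ` a measurable velocity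
observable bounded by `C_φ`, `x_s` a position configuration and `bad` a measurable set of velocity
configurations such that `|A - B| ≤ η e^{-β E}` at `(x_s, V_s)` for every `V_s ∉ bad`. Then
`|I_φ(A)(x_s) - I_φ(B)(x_s)| ≤ C_φ (η ∫ e^{-β E} dV_s + 2 M ∫_{bad} e^{-β E} dV_s)` (`E = ½ ∑ |v_i|²`)
— the bad set is paid with the a priori bounds, the good set with the pointwise estimate (the
mechanism of GST 2013 Ch. 14: pathological velocities are removed before the pseudo-trajectories
are compared). [cite: GST2013, arXiv text Ch. 18 §2 (proof of Thm 8), p. 87] -/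
theorem abs_velocityAverage_sub_le_of_forall_notMem {φ : (Fin s → EuclideanSpace ℝ d) → ℝ} {Cφ : ℝ}
    (hφm : Measurable φ) (hφb : ∀ V, |φ V| ≤ Cφ) {A B : Config s d X → ℝ} (hAm : Measurable A)
    (hBm : Measurable B) {Mb β : ℝ} (hβ : 0 < β)
    (hA : ∀ Z, |A Z| ≤ Mb * exp (-β * configEnergy Z)) (hB : ∀ Z, |B Z| ≤ Mb * exp (-β * configEnergy Z))
    (xs : Fin s → X) {bad : Set (Fin s → EuclideanSpace ℝ d)} (hbad : MeasurableSet bad) {η : ℝ}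
    (hη : 0 ≤ η)
    (hclose : ∀ V ∉ bad, |A (fun i => (xs i, V i)) - B (fun i => (xs i, V i))| ≤
      η * exp (-β * configEnergy (fun i => (xs i, V i) : Config s d X))) :
    |velocityAverage φ A xs - velocityAverage φ B xs| ≤
      Cφ * (η * (∫ V : Fin s → EuclideanSpace ℝ d, exp (-β * (2⁻¹ * ∑ i, ‖V i‖ ^ 2))) +
        2 * Mb * (∫ V in bad, exp (-β * (2⁻¹ * ∑ i, ‖V i‖ ^ 2)))) := by
  -- the zipping map and the Gaussian weight
  obtain ⟨Z, hZ⟩ : ∃ Z : (Fin s → EuclideanSpace ℝ d) → Config s d X, Z = fun V i => (xs i, V i) :=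
    ⟨_, rfl⟩
  have hZm : Measurable Z := by rw [hZ]; exact measurable_zipVel xs
  obtain ⟨w, hw⟩ : ∃ w : (Fin s → EuclideanSpace ℝ d) → ℝ, w = fun V => exp (-β * (2⁻¹ * ∑ i, ‖V i‖ ^ 2)) :=
    ⟨_, rfl⟩
  have hEw : ∀ V, exp (-β * configEnergy (Z V)) = w V := fun V => by
    rw [hw, hZ, configEnergy_zipVel]
  have hw0 : ∀ V, 0 ≤ w V := fun V => by rw [hw]; exact (exp_pos _).le
  have hwi : Integrable w := by
    have h := integrable_exp_neg_mul_configEnergy_zipVel (d := d) hβ xs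
    simp only [configEnergy_zipVel] at h
    rw [hw]; exact h
  have hCφ : 0 ≤ Cφ := (abs_nonneg _).trans (hφb 0)
  have hA' : ∀ V, |A (Z V)| ≤ Mb * w V := fun V => by rw [← hEw]; exact hA _
  have hB' : ∀ V, |B (Z V)| ≤ Mb * w V := fun V => by rw [← hEw]; exact hB _
  have hclose' : ∀ V ∉ bad, |A (Z V) - B (Z V)| ≤ η * w V := fun V hV => by
    rw [← hEw, hZ]; exact hclose V hV
  have hMb : 0 ≤ Mb := by
    have h := (abs_nonneg _).trans (hA' 0)
    exact nonneg_of_mul_nonneg_left h (lt_of_lt_of_le (exp_pos _) (le_of_eq (hEw 0)))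
  -- integrability of the two velocity integrands
  have hint_of_bound : ∀ {g : Config s d X → ℝ}, Measurable g →
      (∀ V, |g (Z V)| ≤ Mb * w V) → Integrable (fun V => φ V * g (Z V)) volume := by
    intro g hg hgb
    refine (hwi.const_mul (Cφ * Mb)).mono' ((hφm.mul (hg.comp hZm)).aestronglyMeasurable)
      (Eventually.of_forall fun V => ?_)
    rw [Real.norm_eq_abs, abs_mul]
    calc |φ V| * |g (Z V)| ≤ Cφ * (Mb * w V) := mul_le_mul (hφb V) (hgb V) (abs_nonneg _) hCφ
      _ = Cφ * Mb * w V := by ring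
  have hIA : Integrable (fun V => φ V * A (Z V)) volume := hint_of_bound hAm hA'
  have hIB : Integrable (fun V => φ V * B (Z V)) volume := hint_of_bound hBm hB'
  -- the difference of the averages is the average of the difference
  have hsub : velocityAverage φ A xs - velocityAverage φ B xs = ∫ V, φ V * (A (Z V) - B (Z V)) := by
    have h1 := hIA
    have h2 := hIB
    simp only [hZ] at h1 h2
    simp only [velocityAverage]
    rw [← integral_sub h1 h2]
    refine integral_congr_ae (Eventually.of_forall fun V => ?_)
    rw [hZ]
    simp only
    ring
  -- pointwise majorant
  obtain ⟨g, hg⟩ : ∃ g : (Fin s → EuclideanSpace ℝ d) → ℝ,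
      g = fun V => bad.indicator (fun V => Cφ * (2 * Mb) * w V) V + Cφ * η * w V := ⟨_, rfl⟩
  have hgi : Integrable g := by
    rw [hg]
    exact ((hwi.const_mul (Cφ * (2 * Mb))).indicator hbad).add (hwi.const_mul (Cφ * η))
  have hpt : ∀ V, ‖φ V * (A (Z V) - B (Z V))‖ ≤ g V := by
    intro V
    rw [Real.norm_eq_abs, abs_mul, hg]
    have hgood : 0 ≤ Cφ * η * w V := mul_nonneg (mul_nonneg hCφ hη) (hw0 V)
    by_cases hV : V ∈ bad
    · have h1 : |A (Z V) - B (Z V)| ≤ 2 * Mb * w V := by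
        calc _ ≤ |A (Z V)| + |B (Z V)| := abs_sub _ _
          _ ≤ Mb * w V + Mb * w V := add_le_add (hA' _) (hB' _)
          _ = 2 * Mb * w V := by ring
      simp only [indicator_of_mem hV]
      calc |φ V| * |A (Z V) - B (Z V)| ≤ Cφ * (2 * Mb * w V) :=
            mul_le_mul (hφb V) h1 (abs_nonneg _) hCφ
        _ ≤ Cφ * (2 * Mb) * w V + Cφ * η * w V := by nlinarith [hgood]
    · simp only [indicator_of_notMem hV, zero_add]
      calc |φ V| * |A (Z V) - B (Z V)| ≤ Cφ * (η * w V) :=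
            mul_le_mul (hφb V) (hclose' V hV) (abs_nonneg _) hCφ
        _ = Cφ * η * w V := by ring
  have hgint : ∫ V, g V = Cφ * (2 * Mb) * (∫ V in bad, w V) + Cφ * η * (∫ V, w V) := by
    rw [hg, integral_add ((hwi.const_mul _).indicator hbad) (hwi.const_mul _), integral_indicator hbad,
      integral_const_mul, integral_const_mul]
  rw [hsub]
  calc |∫ V, φ V * (A (Z V) - B (Z V))| = ‖∫ V, φ V * (A (Z V) - B (Z V))‖ := (Real.norm_eq_abs _).symm
    _ ≤ ∫ V, g V := norm_integral_le_of_norm_le hgi (Eventually.of_forall hpt)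
    _ = Cφ * (2 * Mb) * (∫ V in bad, w V) + Cφ * η * (∫ V, w V) := hgint
    _ = Cφ * (η * (∫ V, w V) + 2 * Mb * (∫ V in bad, w V)) := by ring
    _ = _ := by rw [hw]

/-- **Term-by-term convergence in the sense of observables from pointwise convergence off bad sets**
(the hypothesis `hconv` of `tendstoMarginals_of_hasSum` / `propagatesChaos_of_hasSum`, one term at a
time, in the form GST 2013 Part III produces it). At a fixed level `s`: if `A_k(t)`, `B(t)` are
measurable with the common Gaussian bound `M e^{-β E}` for `t ∈ S`, and for every `η > 0`,
eventually in `k`, for all `t ∈ S` and `x_s ∈ K` there is a measurable bad set of velocity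
configurations of Gaussian measure `∫_{bad} e^{-β E} dV_s ≤ η` off which `|A_k(t) - B(t)| ≤ η e^{-β E}`
at `(x_s, ·)`, then for every bounded measurable observable `φ` and `δ > 0`, eventually
`|I_φ(A_k(t))(x_s) - I_φ(B(t))(x_s)| ≤ δ` for all `t ∈ S`, `x_s ∈ K`. [cite: GST2013, arXiv text Ch. 9 §2 and Ch. 18 §2, pp. 39, 87] -/
theorem forall_abs_velocityAverage_sub_le_of_bad {S : Set ℝ} {K : Set (Fin s → X)}
    {φ : (Fin s → EuclideanSpace ℝ d) → ℝ} {Cφ : ℝ} (hφm : Measurable φ) (hφb : ∀ V, |φ V| ≤ Cφ)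
    {A : ℕ → ℝ → Config s d X → ℝ} {B : ℝ → Config s d X → ℝ}
    (hAm : ∀ k, ∀ t ∈ S, Measurable (A k t)) (hBm : ∀ t ∈ S, Measurable (B t))
    {Mb β : ℝ} (hβ : 0 < β) (hMb : 0 ≤ Mb)
    (hAb : ∀ k, ∀ t ∈ S, ∀ Z, |A k t Z| ≤ Mb * exp (-β * configEnergy Z))
    (hBb : ∀ t ∈ S, ∀ Z, |B t Z| ≤ Mb * exp (-β * configEnergy Z))
    (h : ∀ η > (0 : ℝ), ∀ᶠ k in atTop, ∀ t ∈ S, ∀ xs ∈ K,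
      ∃ bad : Set (Fin s → EuclideanSpace ℝ d), MeasurableSet bad ∧
        (∫ V in bad, exp (-β * (2⁻¹ * ∑ i, ‖V i‖ ^ 2))) ≤ η ∧
        ∀ V ∉ bad, |A k t (fun i => (xs i, V i)) - B t (fun i => (xs i, V i))| ≤
          η * exp (-β * configEnergy (fun i => (xs i, V i) : Config s d X))) :
    ∀ δ > (0 : ℝ), ∀ᶠ k in atTop, ∀ t ∈ S, ∀ xs ∈ K,
      |velocityAverage φ (A k t) xs - velocityAverage φ (B t) xs| ≤ δ := by
  intro δ hδ
  have hCφ : 0 ≤ Cφ := (abs_nonneg _).trans (hφb 0)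
  -- the Gaussian integral over the velocities
  set I₀ : ℝ := ∫ V : Fin s → EuclideanSpace ℝ d, exp (-β * (2⁻¹ * ∑ i, ‖V i‖ ^ 2)) with hI₀
  have hI₀0 : 0 ≤ I₀ := integral_nonneg fun V => (exp_pos _).le
  -- choice of `η`
  set η : ℝ := δ / (Cφ * (I₀ + 2 * Mb) + 1) with hη
  have hden : 0 < Cφ * (I₀ + 2 * Mb) + 1 := by positivity
  have hη0 : 0 < η := div_pos hδ hden
  filter_upwards [h η hη0] with k hk t ht xs hxs
  obtain ⟨bad, hbad, hbadI, hclose⟩ := hk t ht xs hxs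
  have hmain := abs_velocityAverage_sub_le_of_forall_notMem hφm hφb (hAm k t ht) (hBm t ht) hβ
    (hAb k t ht) (hBb t ht) xs hbad hη0.le hclose
  refine hmain.trans ?_
  calc Cφ * (η * I₀ + 2 * Mb * (∫ V in bad, exp (-β * (2⁻¹ * ∑ i, ‖V i‖ ^ 2))))
      ≤ Cφ * (η * I₀ + 2 * Mb * η) := by gcongr
    _ = η * (Cφ * (I₀ + 2 * Mb)) := by ring
    _ ≤ η * (Cφ * (I₀ + 2 * Mb) + 1) := by gcongr; linarith
    _ = δ := by rw [hη]; field_simp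

/-- **The Gaussian tail of the energy truncation**: `∫_{∑ |v_i|² > R} e^{-β E(V_s)} dV_s → 0` as
`R → ∞` (`β > 0`, `E = ½ ∑ |v_i|²`) — the velocity configurations of large energy form a bad set of
small Gaussian measure (GST 2013, arXiv text Ch. 9 §2 "Energy truncation", p. 39: the energy
truncation costs `C e^{-C' β₀ R²}`; here only the qualitative statement). [cite: GST2013, arXiv text Ch. 9 §2, p. 39] -/
theorem tendsto_setIntegral_exp_neg_mul_sum_norm_sq {β : ℝ} (hβ : 0 < β) (s : ℕ) :
    Tendsto (fun R : ℝ => ∫ V in {V : Fin s → EuclideanSpace ℝ d | R < ∑ i, ‖V i‖ ^ 2},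
      exp (-β * (2⁻¹ * ∑ i, ‖V i‖ ^ 2))) atTop (𝓝 0) := by
  have hmeas : ∀ R : ℝ, MeasurableSet {V : Fin s → EuclideanSpace ℝ d | R < ∑ i, ‖V i‖ ^ 2} := by
    intro R
    have hc : Measurable fun V : Fin s → EuclideanSpace ℝ d => ∑ i, ‖V i‖ ^ 2 := by fun_prop
    exact measurableSet_lt measurable_const hc
  have hanti : Antitone fun R : ℝ => {V : Fin s → EuclideanSpace ℝ d | R < ∑ i, ‖V i‖ ^ 2} :=
    fun R R' hRR' V (hV : R' < _) => lt_of_le_of_lt hRR' hV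
  have hempty : (⋂ R : ℝ, {V : Fin s → EuclideanSpace ℝ d | R < ∑ i, ‖V i‖ ^ 2}) = ∅ := by
    ext V
    simp only [mem_iInter, mem_setOf_eq, mem_empty_iff_false, iff_false, not_forall, not_lt]
    exact ⟨∑ i, ‖V i‖ ^ 2, le_rfl⟩
  have hwi : Integrable fun V : Fin s → EuclideanSpace ℝ d => exp (-β * (2⁻¹ * ∑ i, ‖V i‖ ^ 2)) := by
    have h := integrable_exp_neg_mul_configEnergy_zipVel (d := d) (X := Unit) hβ
      (fun _ : Fin s => ())
    simp only [configEnergy_zipVel] at h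
    exact h
  have h := tendsto_setIntegral_of_antitone hmeas hanti ⟨0, hwi.integrableOn⟩
  rwa [hempty, Measure.restrict_empty, integral_zero_measure] at h

end BadSets

/-! ## §2. The Ukai–Lanford solution with a bound uniform over the Lanford class -/

section Ukai

variable {X : Type*}

/-- Continuity in time with values in `X_β` restricts to smaller time sets. [folklore] -/
theorem _root_.Literature.Analysis.FluidPDE.ContinuousInLanfordOn.mono [TopologicalSpace X] {S S' : Set ℝ}
    {β : ℝ} {f : ℝ → X → EuclideanSpace ℝ d → ℝ} (hf : ContinuousInLanfordOn S β f) (hS : S' ⊆ S) :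
    ContinuousInLanfordOn S' β f :=
  ⟨fun t ht => hf.1 t (hS ht), fun t₀ ht₀ => (hf.2 t₀ (hS ht₀)).mono_left (nhdsWithin_mono _ hS)⟩

/-- **The Ukai–Lanford solution, with a Gaussian bound uniform over the Lanford class** (GST 2013
Part I Ch. 2 §3.1 Thm 1 and Part II Ch. 5 Thm 7; CIP 1994 Thm 4.4.1 Step 4): for `β₀, C₀ > 0` there
is `T₀ = T₀(d, β₀, C₀) > 0` such that every Lanford datum `f₀` (`0 ≤ f₀ ≤ C₀ e^{-β₀|v|²/2}`,
continuous) is the initial value of a mild hard-sphere Boltzmann solution on `[0, T₀] × T^d` which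
is continuous in time with values in `X_{β₀/2}` and satisfies `|f(t, x, v)| ≤ 2 C₀ e^{-β₀|v|²/4}` for
`t ∈ [0, T₀]`. Existence in the class is `ukai_lanford_lwp_holds`; the uniform bound is that of the
scale-space solution of `hardSphere_mild_exists`, transferred by uniqueness in the wide class
(`hardSphere_mild_unique`) on the common interval. [cite: GST2013, Part I Ch. 2 §3.1 Thm 1; Part II Ch. 5 Thm 7] -/
theorem exists_ukaiLanford_uniform {β₀ C₀ : ℝ} (hβ₀ : 0 < β₀) (hC₀ : 0 < C₀) :
    ∃ T₀ > (0 : ℝ), ∀ f₀ : UnitAddTorus d → EuclideanSpace ℝ d → ℝ, IsLanfordDatum β₀ C₀ f₀ →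
      ∃ f : ℝ → UnitAddTorus d → EuclideanSpace ℝ d → ℝ,
        ContinuousInLanfordOn (Icc 0 T₀) (β₀ / 2) f ∧
        IsMildBoltzmannSolutionOn T₀ (Torus.geometry d) hardSphereKernel f ∧ f 0 = f₀ ∧
        ∀ t ∈ Icc 0 T₀, ∀ x v, |f t x v| ≤ 2 * C₀ * exp (-(β₀ / 2 / 2) * ‖v‖ ^ 2) := by
  obtain ⟨T₁, hT₁, hlwp⟩ := ukai_lanford_lwp_holds (d := d) hβ₀ hC₀
  obtain ⟨T₂, hT₂, hE⟩ := hardSphere_mild_exists (d := d) hβ₀ hC₀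
  refine ⟨min T₁ T₂, lt_min hT₁ hT₂, fun f₀ hf₀ => ?_⟩
  obtain ⟨⟨f, hfC, hfM, hf0⟩, -⟩ := hlwp f₀ hf₀.1 hf₀.2.1 hf₀.2.2
  have hf₀c : Continuous (Function.uncurry f₀) := hf₀.2.1.1
  have hf₀b : ∀ x v, |f₀ x v| ≤ C₀ * exp (-(β₀ / 2) * ‖v‖ ^ 2) :=
    abs_le_of_eGaussSupNorm_le hC₀.le hf₀.2.2
  obtain ⟨u, hu, hu0, huc, hub⟩ := hE f₀ hf₀.1 hf₀c hf₀b
  -- both restricted to the common interval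
  have hfC' : ContinuousInLanfordOn (Icc 0 (min T₁ T₂)) (β₀ / 2) f :=
    hfC.mono (Icc_subset_Icc_right (min_le_left _ _))
  have hfM' : IsMildBoltzmannSolutionOn (min T₁ T₂) (Torus.geometry d) hardSphereKernel f :=
    hfM.mono (min_le_left _ _)
  have hu' : IsMildBoltzmannSolutionOn (min T₁ T₂) (Torus.geometry d) hardSphereKernel u :=
    hu.mono (min_le_right _ _)
  refine ⟨f, hfC', hfM', hf0, fun t ht x v => ?_⟩
  -- a common (non-uniform) Gaussian bound, for uniqueness only
  obtain ⟨Nf, -, hNf⟩ := exists_abs_le_of_continuousInLanfordOn hfC'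
  set N : ℝ := max Nf (2 * C₀) with hN
  have hfb : ∀ s ∈ Icc 0 (min T₁ T₂), ∀ x v, |f s x v| ≤ N * exp (-(β₀ / 2 / 2) * ‖v‖ ^ 2) :=
    fun s hs x v => (hNf s hs x v).trans (mul_le_mul_of_nonneg_right (le_max_left _ _) (exp_pos _).le)
  have hub' : ∀ s ∈ Icc 0 (min T₁ T₂), ∀ x v, |u s x v| ≤ N * exp (-(β₀ / 2 / 2) * ‖v‖ ^ 2) :=
    fun s _ x v => (hub s x v).trans (mul_le_mul_of_nonneg_right (le_max_right _ _) (exp_pos _).le)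
  have hfc : ∀ s ∈ Icc 0 (min T₁ T₂), Continuous (Function.uncurry (f s)) := fun s hs => (hfC'.1 s hs).1
  have huc' : ∀ s ∈ Icc 0 (min T₁ T₂), Continuous (Function.uncurry (u s)) := fun s _ => huc s
  have heq : f t = u t :=
    hardSphere_mild_unique (half_pos hβ₀) hfM' hu' hfc huc' hfb hub' (hf0.trans hu0.symm) t ht
  rw [heq]
  exact hub t x v

end Ukai

/-! ## §3. The reduction of `lanford` to the BBGKY-side term-by-term analysis -/

section Assembly

/-- **Lanford's theorem from the BBGKY-side term-by-term analysis** (CIP 1994 Thm 4.4.1, proof,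
Steps 1–4, pp. 77–86; GST 2013 Thm 8 from Thms 6–7 and Part III). Suppose that for all `β₀, C₀ > 0`
(and `d ≥ 2`) there is a horizon `T_B > 0` such that for every Lanford datum `f₀`, every sequence
of diameters `ε_k → 0⁺` (`ε_k < 1/2`) and all hard-sphere flows `Φ k N`, there exist measurable
`s`-particle functions `A_k^{(s),n}(t)` (`t ∈ [0, T_B]`) and constants `M_s`, `0 ≤ r < 1`, `β > 0`
with: the majorants `|A_k^{(s),n}(t)| ≤ M_s rⁿ e^{-β E}`; the representation
`∑_n A_k^{(s),n}(t) = F_k^{(s)}(t)` a.e., `F_k^{(s)}(t)` the rescaled correlation functions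
(`Kinetic.correlationFn`) of the grand-canonical Gibbs state `gcInitial` with activity
`μ_k = ε_k^{-(d-1)}` evolved by the flows (`gcEvolved`); and the term-by-term convergence, in the
sense of observables and locally uniformly off the diagonal, uniformly on `[0, T_B]`, of
`A_k^{(s),n}(t)` to the Boltzmann Duhamel term `Q⁰_{s,s+n}(t) f₀^{⊗(s+n)}`
(`Kinetic.boltzmannDuhamelTerm`). Then Lanford's theorem `lanford` (hilbert6.S02) holds, with
`T = min (T₀, T_Σ, T_B)` (`exists_ukaiLanford_uniform`, the summation time of
`IsMildBoltzmannSolutionOn.hasSum_boltzmannDuhamelTerm_tensorPow_of_le`, the horizon of the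
hypothesis). Proof: the limit is the Ukai–Lanford solution `f`; its tensor powers are the sums of the
Boltzmann Duhamel series with majorants `(1 + e^{s-1}) N^s 2^{-n} e^{-(β₀/4) E}`, `N = max (2C₀, 1)`
(Steps 3–4, Boltzmann side); the versions of the correlation functions are the sums `∑_n A_k^{(s),n}`;
and mode-A convergence is dominated convergence of the two series (`propagatesChaos_of_hasSum`,
Step 2) with the merged majorants `max (M_s, (1 + e^{s-1}) N^s) max(r, 1/2)ⁿ e^{-min(β, β₀/4) E}`.
[cite: CIP1994, §4.4 Thm 4.4.1, proof, Steps 1–4, pp. 77–86] -/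
theorem lanford_of_bbgkySide
    (h : ∀ (_hd : 2 ≤ Fintype.card d) {β₀ C₀ : ℝ}, 0 < β₀ → 0 < C₀ →
      ∃ T_B > (0 : ℝ), ∀ f₀ : UnitAddTorus d → EuclideanSpace ℝ d → ℝ, IsLanfordDatum β₀ C₀ f₀ →
        ∀ ε : ℕ → ℝ, (∀ k, 0 < ε k) → (∀ k, ε k < 2⁻¹) → Tendsto ε atTop (𝓝 0) →
          ∀ Φ : (k N : ℕ) → HardSphereFlow (Torus.geometry d) (ε k) N,
            ∃ (A : ℕ → (s : ℕ) → ℕ → ℝ → Config s d (UnitAddTorus d) → ℝ) (M : ℕ → ℝ) (r β : ℝ),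
              0 ≤ r ∧ r < 1 ∧ 0 < β ∧
              (∀ k s n, ∀ t ∈ Icc 0 T_B, Measurable (A k s n t)) ∧
              (∀ k s n, ∀ t ∈ Icc 0 T_B, ∀ Z, |A k s n t Z| ≤ M s * r ^ n * exp (-β * configEnergy Z)) ∧
              (∀ k s, ∀ t ∈ Icc 0 T_B,
                (fun Z => ∑' n, A k s n t Z) =ᵐ[volume]
                  correlationFn (bgActivity d (ε k))
                    (gcEvolved (Φ k) (gcInitial (Torus.geometry d) (ε k) (bgActivity d (ε k)) (uncurry f₀)) t) s) ∧
              (∀ (s n : ℕ) (φ : (Fin s → EuclideanSpace ℝ d) → ℝ), Continuous φ → HasCompactSupport φ →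
                ∀ K ⊆ offDiag (X := UnitAddTorus d) s, IsCompact K → ∀ δ > (0 : ℝ),
                  ∀ᶠ k in atTop, ∀ t ∈ Icc 0 T_B, ∀ xs ∈ K,
                    |velocityAverage φ (A k s n t) xs -
                      velocityAverage φ (boltzmannDuhamelTerm (Torus.geometry d) n s t
                        (fun j => tensorPow j (uncurry f₀))) xs| ≤ δ)) :
    lanford (d := d) := by
  intro hd β₀ C₀ hβ₀ hC₀
  haveI := isFiniteMeasure_sphereMeasure (E := EuclideanSpace ℝ d)
  -- the three times
  obtain ⟨T₀, hT₀, hU⟩ := exists_ukaiLanford_uniform (d := d) hβ₀ hC₀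
  obtain ⟨T_B, hT_B, hB⟩ := h hd hβ₀ hC₀
  set N : ℝ := max (2 * C₀) 1 with hN
  have hN1 : 1 ≤ N := le_max_right _ _
  set Cst : ℝ := exp 2 * sqrt 2 ^ (Fintype.card d + 3) *
    ((∫ u : EuclideanSpace ℝ d, (1 + ‖u‖) * exp (-(1 / 2) * ‖u‖ ^ 2)) *
      (sphereMeasure : Measure (sphere (0 : EuclideanSpace ℝ d) 1)).real univ) + 1 with hCst
  have hJ : 0 ≤ ∫ u : EuclideanSpace ℝ d, (1 + ‖u‖) * exp (-(1 / 2) * ‖u‖ ^ 2) :=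
    integral_nonneg fun u => by positivity
  have hCst0 : 0 < Cst := by
    have : 0 ≤ (∫ u : EuclideanSpace ℝ d, (1 + ‖u‖) * exp (-(1 / 2) * ‖u‖ ^ 2)) *
        (sphereMeasure : Measure (sphere (0 : EuclideanSpace ℝ d) 1)).real univ :=
      mul_nonneg hJ measureReal_nonneg
    positivity
  have hsβ : 0 < sqrt (β₀ / 2) ^ (Fintype.card d + 1) := pow_pos (sqrt_pos.2 (half_pos hβ₀)) _
  set T_S : ℝ := sqrt (β₀ / 2) ^ (Fintype.card d + 1) / (2 * Cst * N) with hT_S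
  have hT_S0 : 0 < T_S := by positivity
  set T : ℝ := min T₀ (min T_S T_B) with hT
  have hT0 : 0 < T := lt_min hT₀ (lt_min hT_S0 hT_B)
  have hTT₀ : T ≤ T₀ := min_le_left _ _
  have hTT_S : T ≤ T_S := (min_le_right _ _).trans (min_le_left _ _)
  have hTT_B : T ≤ T_B := (min_le_right _ _).trans (min_le_right _ _)
  refine ⟨T, hT0, fun f₀ hf₀ => ?_⟩
  -- the Ukai–Lanford solution on `[0, T]`
  obtain ⟨f, hfC, hfM, hf0, hfb⟩ := hU f₀ hf₀
  have hfC' : ContinuousInLanfordOn (Icc 0 T) (β₀ / 2) f := hfC.mono (Icc_subset_Icc_right hTT₀)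
  have hfM' : IsMildBoltzmannSolutionOn T (Torus.geometry d) hardSphereKernel f := hfM.mono hTT₀
  have hfN : ∀ t ∈ Icc 0 T, ∀ x v, |f t x v| ≤ N * exp (-(β₀ / 2 / 2) * ‖v‖ ^ 2) :=
    fun t ht x v => (hfb t (Icc_subset_Icc_right hTT₀ ht) x v).trans
      (mul_le_mul_of_nonneg_right (le_max_left _ _) (exp_pos _).le)
  refine ⟨f, hfC', hfM', hf0, fun ε hε hε' hε0 Φ => ?_⟩
  -- the BBGKY side
  obtain ⟨A, M, r, β, hr0, hr1, hβ, hAm, hAb, hAae, hconv⟩ := hB f₀ hf₀ ε hε hε' hε0 Φ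
  -- the Boltzmann side: Duhamel series of the tensor powers on `[0, T]`
  have hsmall : ∀ t ∈ Icc 0 T, 2 * Cst * N * t ≤ sqrt (β₀ / 2) ^ (Fintype.card d + 1) := by
    intro t ht
    have h1 : t ≤ sqrt (β₀ / 2) ^ (Fintype.card d + 1) / (2 * Cst * N) := ht.2.trans hTT_S
    have h2 : 0 < 2 * Cst * N := by positivity
    calc 2 * Cst * N * t ≤ 2 * Cst * N * (sqrt (β₀ / 2) ^ (Fintype.card d + 1) / (2 * Cst * N)) := by
          gcongr
      _ = sqrt (β₀ / 2) ^ (Fintype.card d + 1) := by field_simp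
  have hBoltz := fun t (ht : t ∈ Icc 0 T) (s : ℕ) (Z : Config s d (UnitAddTorus d)) =>
    hfM'.hasSum_boltzmannDuhamelTerm_tensorPow_of_le (half_pos hβ₀) hN1 hfC' hfN ht (hsmall t ht) s Z
  -- data of the Boltzmann side are nice (measurability of the Boltzmann Duhamel terms)
  have hf₀c : Continuous (Function.uncurry f₀) := hf₀.2.1.1
  have hf₀b : ∀ x v, |f₀ x v| ≤ C₀ * exp (-(β₀ / 2) * ‖v‖ ^ 2) :=
    abs_le_of_eGaussSupNorm_le hC₀.le hf₀.2.2
  have hGm : Measurable fun p : UnitAddTorus d × EuclideanSpace ℝ d => (Torus.geometry d).translate p.1 p.2 :=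
    Torus.continuous_translate_uncurry.measurable
  have hnice : ∀ j, IsNice (tensorPow j (uncurry f₀) : Config j d (UnitAddTorus d) → ℝ) := fun j =>
    ⟨measurable_tensorPow hf₀c.measurable j,
      ⟨C₀ ^ j, β₀, hβ₀, fun Z => abs_tensorPow_le_pow_mul_exp (fun z => hf₀b z.1 z.2) Z⟩⟩
  have hBterm_meas : ∀ s n, ∀ t ∈ Icc 0 T,
      Measurable (boltzmannDuhamelTerm (Torus.geometry d) n s t (fun j => tensorPow j (uncurry f₀))) := by
    intro s n t ht
    have hm := (isNice_duhamelTerm (boltzmannModel (Torus.geometry d) hGm 1) hnice n s ht.1).1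
    have heq : duhamelTerm (boltzmannModel (Torus.geometry d) hGm 1).transport
        (boltzmannModel (Torus.geometry d) hGm 1).op n s t (fun j => tensorPow j (uncurry f₀)) =
        boltzmannDuhamelTerm (Torus.geometry d) n s t (fun j => tensorPow j (uncurry f₀)) := by
      funext Z
      rw [duhamelTerm_boltzmannModel, one_pow, one_mul]
    rwa [heq] at hm
  -- merged majorants
  set M' : ℕ → ℝ := fun s => max (max (M s) 0) ((1 + exp (s - 1 : ℝ)) * N ^ s) with hM'
  set r' : ℝ := max r 2⁻¹ with hr'
  set β' : ℝ := min β (β₀ / 2 / 2) with hβ'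
  have hr'0 : 0 ≤ r' := hr0.trans (le_max_left _ _)
  have hr'1 : r' < 1 := max_lt hr1 (by norm_num)
  have hβ'0 : 0 < β' := lt_min hβ (by positivity)
  have hE0 : ∀ {s : ℕ} (Z : Config s d (UnitAddTorus d)), 0 ≤ configEnergy Z := fun Z => by
    unfold configEnergy; positivity
  have hmono : ∀ {s : ℕ} (n : ℕ) (Z : Config s d (UnitAddTorus d)) {m ρ γ : ℝ}, 0 ≤ m → m ≤ M' s →
      0 ≤ ρ → ρ ≤ r' → β' ≤ γ →
      m * ρ ^ n * exp (-γ * configEnergy Z) ≤ M' s * r' ^ n * exp (-β' * configEnergy Z) := by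
    intro s n Z m ρ γ hm hmM hρ hρr hγ
    have h1 : ρ ^ n ≤ r' ^ n := pow_le_pow_left₀ hρ hρr n
    have h2 : exp (-γ * configEnergy Z) ≤ exp (-β' * configEnergy Z) :=
      exp_le_exp.2 (by nlinarith [hE0 Z])
    have hM'0 : 0 ≤ M' s := hm.trans hmM
    calc m * ρ ^ n * exp (-γ * configEnergy Z) ≤ M' s * r' ^ n * exp (-γ * configEnergy Z) := by
          gcongr
      _ ≤ M' s * r' ^ n * exp (-β' * configEnergy Z) := by gcongr
  -- the versions: sums of the BBGKY Duhamel series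
  have hAsum : ∀ k s, ∀ t ∈ Icc 0 T, ∀ Z, HasSum (fun n => A k s n t Z) (∑' n, A k s n t Z) := by
    intro k s t ht Z
    have htB : t ∈ Icc 0 T_B := Icc_subset_Icc_right hTT_B ht
    refine (Summable.of_norm_bounded (g := fun n => max (M s) 0 * r ^ n * exp (-β * configEnergy Z))
      (((summable_geometric_of_lt_one hr0 hr1).mul_left _).mul_right _) fun n => ?_).hasSum
    rw [Real.norm_eq_abs]
    exact (hAb k s n t htB Z).trans (by gcongr; exact le_max_left _ _)
  refine ⟨fun k s t Z => ∑' n, A k s n t Z, fun k s t ht => hAae k s t (Icc_subset_Icc_right hTT_B ht), ?_⟩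
  -- mode-A convergence by dominated convergence of the two series
  refine propagatesChaos_of_hasSum (f := fun t z => f t z.1 z.2)
    (fun s k n t => A k s n t)
    (fun s n t => boltzmannDuhamelTerm (Torus.geometry d) n s t (fun j => tensorPow j (uncurry f₀)))
    M' hβ'0 hr'0 hr'1 ?_ ?_ ?_ ?_ ?_ ?_ ?_
  · exact fun s k n t ht => hAm k s n t (Icc_subset_Icc_right hTT_B ht)
  · exact fun s n t ht => hBterm_meas s n t ht
  · intro s k n t ht Z
    refine (hAb k s n t (Icc_subset_Icc_right hTT_B ht) Z).trans ?_
    refine (mul_le_mul_of_nonneg_right (mul_le_mul_of_nonneg_right (le_max_left (M s) 0)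
      (pow_nonneg hr0 n)) (exp_pos _).le).trans ?_
    exact hmono n Z (le_max_right _ _) (le_max_left _ _) hr0 (le_max_left _ _) (min_le_left _ _)
  · intro s n t ht Z
    rw [← hf0]
    refine ((hBoltz t ht s Z).1 n).trans ?_
    have h1 : 0 ≤ (1 + exp (s - 1 : ℝ)) * N ^ s := by positivity
    exact hmono n Z h1 (le_max_right _ _) (by norm_num) (le_max_right _ _) (min_le_right _ _)
  · exact fun s k t ht Z => hAsum k s t ht Z
  · intro s t ht Z
    have h2 := (hBoltz t ht s Z).2
    rw [hf0] at h2
    exact h2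
  · intro s n φ hφ hφc K hK hKc δ hδ
    filter_upwards [hconv s n φ hφ hφc K hK hKc δ hδ] with k hk t ht xs hxs
    exact hk t (Icc_subset_Icc_right hTT_B ht) xs hxs

end Assembly

end

end Literature.MathematicalPhysics.KineticTheory
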